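import Summits.ResolutionOfSingularities.ResolutionOfSingularities.Theses.HilbertSamuelElimination
import Summits.ResolutionOfSingularities.ResolutionOfSingularities.Theorems.HilbertSamuelEliminationSigmaMaxModificationsReductionBase
import Summits.ResolutionOfSingularities.ResolutionOfSingularities.Theorems.HilbertSamuelEliminationSigmaMaxModificationsCorridor3LevelRaiseDim
import Summits.ResolutionOfSingularities.ResolutionOfSingularities.Theorems.HilbertSamuelEliminationSigmaMaxModificationsCorridor3TameWildDefs
import Mathlib.AlgebraicGeometry.Morphisms.Proper
import Mathlib.AlgebraicGeometry.Noetherian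
import HarnessLib

/-!
# `SigmaMaxModificationsCorridor3` (crux stmt-ResolutionOfSingularities-19249, child of
# `SigmaMaxModifications` stmt-ResolutionOfSingularities-18506, route HilbertSamuelElimination):
# THE BINDING LEVEL SUFFICES — `Corridor3@3 → SigmaMaxModificationsCorridor3` modulo the two
# printed theorems

[OURS · L1 W4.2] The kernel form of the (inactive, stub-archived) line `corridor3_levels`
(`Cruxes/SigmaMaxModificationsCorridor3/Lines/corridor3_levels.lean`, strategist 2026-08-17) as a
CITABLE theorem, now that its one provable stub `stub_levelRaiseDim` is landed (`levelRaiseDim`,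
`…Corridor3LevelRaiseDim.lean`, p456602). NOT a statement of any manuscript.

The crux `SigmaMaxModificationsCorridor3` quantifies over EVERY level `N ≥ 3` (threefolds with
the corridor condition at level `N`), and the level matters (`X_max(N+1) ⊊ X_max(N)` happens:
refuter kit `Negative/Levels`). Write `B(X, N)` (`HSBody X N`, Theorems-side vocabulary
`…Corridor3TameWildDefs.lean`, p456933) for the seven-clause body and `Corridor3@3` for the crux at
the ONE level `N = 3`:

  `Corridor3@3 := ∀ p prime, ∀ k [Field k] [CharP k p] X f, IsSeparated f →
    LocallyOfFiniteType f → QuasiCompact f → IsReduced X → ¬ IsRegular X → 3 ≤ dim X →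
    dim X ≤ 3 → ¬ Disjoint (closure (Sing X ∖ X_max(3))) (X_max(3)) → B(X, 3)`

(verbatim the lead's `stub_dim_three_corridor_base` of line `Sketch` / `stub_corridor3_base` of
`corridor3_levels` / the hypothesis `hcor` of `sigmaMaxModifications_of_base_cores`, p164038;
`HSBody` unfolds by `rfl`). This file proves

* `hsBody_of_dim_le_three_of_base hCJS hCP hcor` : `B(X, N)` for every reduced separated
  finite-type non-regular `X/k` with `dim X ≤ 3` and every `N ≥ dim X` — induction on `N`;
  `dim X ≤ N - 1` is `levelRaiseDim` with `d = 3`; `dim X = N` is a binding level: curves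
  (`stub_curve` ∘ `stub_curveResolution`, p156715/p156708, unconditional), surfaces at level `2`
  (`sigmaMaxModifications_dim_le_two`, p148824, from the CJS fact), threefolds at level `3` with
  ISOLATED `X_max(3)` (`sigmaMaxModifications_dim_le_three_of_isolated`, p154168, from the CP fact;
  closedness of `X_max(3)` by p157713/p158563) or the corridor core `hcor`;
* `SigmaMaxModificationsCorridor3_of_base hCJS hCP hcor : SigmaMaxModificationsCorridor3` — the
  crux BY NAME (its inline `H^N` / `X_max` / `Sing X` are `Scheme.hsFun` / `hsMaxLocus` /
  `(regularLocus X)ᶜ` by `rfl`); the corridor hypothesis at level `N ≥ 4` is simply dropped;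
* `corridor3_base_of_corridor3 : SigmaMaxModificationsCorridor3 → Corridor3@3` (fact-free) and
  `sigmaMaxModificationsCorridor3_iff_base hCJS hCP : SigmaMaxModificationsCorridor3 ↔ Corridor3@3`.

Here `hCJS : CossartJannsenSaito2020_sigmaMaxElimination` (CJS LNM 2270 Thm. 6.28 with Def. 6.15
and Thm. 3.10 (1), `dim ≤ 2`) and `hCP : CossartPiltant2019General` (CP 2019 Thm. 1.1) are the
tree's two unproved named facts — PRINTED theorems, so these results are CONDITIONAL on print
debt only (item `SigmaMaxModificationsLowDim`, stmt-…-19251). What the file buys: item 19249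
reduces to `Corridor3@3` WITHOUT touching dimension `≥ 4` (the parent's reductions
`body_allLevels_of_baseLevel` / `sigmaMaxModifications_iff_base_cores` needed `DimGe4@base` to
pass level `4`).

## Sources

* V. Cossart, U. Jannsen, S. Saito, LNM 2270 (2020): Def. 2.28, Rem. 2.29 (b), Lemma 2.36,
  Def. 6.14/6.15, Cor. 6.18, Thm. 6.28, Rem. 6.29. [CossartJannsenSaito2020]
* V. Cossart, O. Piltant, J. Algebra 529 (2019), Thm. 1.1, §1. [CossartPiltant2019]
-/

set_option linter.dupNamespace false -- mandated namespace of this single-conjunct summit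

noncomputable section

open CategoryTheory AlgebraicGeometry TopologicalSpace Topology
open Literature.AlgebraicGeometry.Resolution Literature.RingTheory.HilbertSamuel
open Summit.ResolutionOfSingularities.ResolutionOfSingularities.Theses.HilbertSamuelElimination
open Summit.ResolutionOfSingularities.ResolutionOfSingularities.Theorems.SigmaMaxModifications.Sketch
open Summit.ResolutionOfSingularities.ResolutionOfSingularities.Theorems.SigmaMaxModificationsCorridor3.TameWild

namespace Summit.ResolutionOfSingularities.ResolutionOfSingularities.Theorems.SigmaMaxModificationsCorridor3

-- adapted from Cruxes/SigmaMaxModificationsCorridor3/Lines/corridor3_levels.lean (strategist's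
-- kernel-checked composition), with the landed `levelRaiseDim` for its `stub_levelRaiseDim` and the
-- two fact stubs / the open core turned into hypotheses.

/-! ## Every level on the class `{dim ≤ 3}` from the binding levels -/

/-- **Every level on the class `{dim ≤ 3}` from the binding levels** (modulo the two printed
theorems and the corridor core at level `3`). Over a field `k` of characteristic `p`: `B(X, N)` for
every reduced separated finite-type non-regular `X/k` with `dim X ≤ 3` and every `N ≥ dim X`.
Induction on `N`: `dim X ≤ N - 1` is `levelRaiseDim` (`d = 3`, p456602) applied to the induction
hypothesis; `dim X = N` is a binding level — `N ≤ 1` curves (p156715/p156708), `N = 2` CJS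
(p148824, `hCJS`), `N = 3` isolated `X_max(3)` (Cossart–Piltant, p154168, `hCP`; closedness
p157713/p158563) or the corridor core `hcor`.
[cite: CossartJannsenSaito2020, Def. 6.15, Rem. 2.29 (b), Rem. 6.29] [cite: CossartPiltant2019, Thm. 1.1] -/
theorem hsBody_of_dim_le_three_of_base (hCJS : CossartJannsenSaito2020_sigmaMaxElimination.{0})
    (hCP : CossartPiltant2019General.{0})
    (hcor : ∀ p : ℕ, p.Prime → ∀ (k : Type) [Field k] [CharP k p] (X : Scheme.{0})
      (f : X ⟶ Spec (.of k)), IsSeparated f → LocallyOfFiniteType f → QuasiCompact f →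
      IsReduced X → ¬ Scheme.IsRegular X → ((3 : ℕ) : WithBot ℕ∞) ≤ topologicalKrullDim X →
      topologicalKrullDim X ≤ ((3 : ℕ) : WithBot ℕ∞) →
      ¬ Disjoint (closure ((Scheme.regularLocus X)ᶜ \ Scheme.hsMaxLocus X 3))
          (Scheme.hsMaxLocus X 3) →
        HSBody X 3)
    (p : ℕ) (hp : p.Prime) (k : Type) [Field k] [CharP k p] :
    ∀ (N : ℕ) (X : Scheme.{0}) (f : X ⟶ Spec (.of k)), IsSeparated f →
      LocallyOfFiniteType f → QuasiCompact f → IsReduced X → ¬ Scheme.IsRegular X →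
      topologicalKrullDim X ≤ ((3 : ℕ) : WithBot ℕ∞) → topologicalKrullDim X ≤ (N : WithBot ℕ∞) →
      HSBody X N := by
  intro N
  induction N with
  | zero =>
    intro X f hsep hft hqc hred hreg _ hdim
    exact stub_curve stub_curveResolution k X f hsep hft hqc hred hreg
      (hdim.trans (by exact_mod_cast (by omega : 0 ≤ 1))) 0 hdim
  | succ N ih =>
    intro X f hsep hft hqc hred hreg hd3 hdim
    rcases dim_le_or_succ_le (topologicalKrullDim X) N with h | h
    · -- `dim X ≤ N`: raise the level on the class `{dim ≤ 3}`
      exact levelRaiseDim k 3 N ih X f hsep hft hqc hred hreg hd3 h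
    · -- `dim X = N + 1 ≤ 3`: a binding level
      have hN3 : N + 1 ≤ 3 := by exact_mod_cast h.trans hd3
      rcases Nat.lt_or_ge (N + 1) 2 with h1 | h2
      · -- curves
        exact stub_curve stub_curveResolution k X f hsep hft hqc hred hreg
          (hdim.trans (by exact_mod_cast (by omega : N + 1 ≤ 1))) (N + 1) hdim
      rcases h2.eq_or_lt with h2 | h3
      · -- surfaces at level `2`
        obtain rfl : N = 1 := by omega
        exact sigmaMaxModifications_dim_le_two hCJS k X f hft hqc hred hreg
          (by exact_mod_cast hdim)
      · -- threefolds at level `3`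
        obtain rfl : N = 2 := by omega
        by_cases hdisj : Disjoint (closure ((Scheme.regularLocus X)ᶜ \ Scheme.hsMaxLocus X 3))
            (Scheme.hsMaxLocus X 3)
        · have hcl : IsClosed (Scheme.hsMaxLocus X 3) :=
            (stub_isClosed_hsMaxLocus_over_field stub_hsFun_le_of_specializes_over_field k X f hft
              hqc 3 hdim).2
          exact sigmaMaxModifications_dim_le_three_of_isolated hCP k X f hsep hft hqc hred hreg
            (by exact_mod_cast hdim) 3 hdim hcl hdisj
        · exact hcor p hp k X f hsep hft hqc hred hreg h hdim hdisj

/-! ## The crux from its binding level -/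

/-- **`Corridor3@3 → SigmaMaxModificationsCorridor3` modulo the two printed theorems** — the
binding level suffices on the class `{dim ≤ 3}`: for `dim X = 3` and any level `N ≥ 3` the body
is `hsBody_of_dim_le_three_of_base`; the corridor hypothesis at level `N` is not needed (it is used,
at `N = 3`, inside the case split). The inline `H^N` / `X_max` / `Sing X` of the route decl are
`Scheme.hsFun` / `Scheme.hsMaxLocus` / `(Scheme.regularLocus X)ᶜ` by `rfl`. Hypotheses: `hCJS` =
CJS Thm. 6.28 (named fact `CossartJannsenSaito2020_sigmaMaxElimination`, print debt), `hCP` = CP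
2019 Thm. 1.1 (named fact `CossartPiltant2019General`, print debt), `hcor` = `Corridor3@3` (the
lead's `stub_dim_three_corridor_base`, OPEN).
[cite: CossartJannsenSaito2020, Def. 6.15, Rem. 6.29] [cite: CossartPiltant2019, Thm. 1.1] -/
theorem SigmaMaxModificationsCorridor3_of_base
    (hCJS : CossartJannsenSaito2020_sigmaMaxElimination.{0}) (hCP : CossartPiltant2019General.{0})
    (hcor : ∀ p : ℕ, p.Prime → ∀ (k : Type) [Field k] [CharP k p] (X : Scheme.{0})
      (f : X ⟶ Spec (.of k)), IsSeparated f → LocallyOfFiniteType f → QuasiCompact f →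
      IsReduced X → ¬ Scheme.IsRegular X → ((3 : ℕ) : WithBot ℕ∞) ≤ topologicalKrullDim X →
      topologicalKrullDim X ≤ ((3 : ℕ) : WithBot ℕ∞) →
      ¬ Disjoint (closure ((Scheme.regularLocus X)ᶜ \ Scheme.hsMaxLocus X 3))
          (Scheme.hsMaxLocus X 3) →
        HSBody X 3) :
    SigmaMaxModificationsCorridor3 := by
  intro p hp k _ _ X f hsep hft hqc hred hreg _ h3' N hdim _ _
  exact hsBody_of_dim_le_three_of_base hCJS hCP hcor p hp k N X f hsep hft hqc hred hreg h3' hdim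

/-- **On-path `SigmaMaxModificationsCorridor3 → Corridor3@3`** (fact-free): the core is the crux at
`N = 3`. [cite: CossartJannsenSaito2020, Def. 6.15] -/
theorem corridor3_base_of_corridor3 (h : SigmaMaxModificationsCorridor3) :
    ∀ p : ℕ, p.Prime → ∀ (k : Type) [Field k] [CharP k p] (X : Scheme.{0})
      (f : X ⟶ Spec (.of k)), IsSeparated f → LocallyOfFiniteType f → QuasiCompact f →
      IsReduced X → ¬ Scheme.IsRegular X → ((3 : ℕ) : WithBot ℕ∞) ≤ topologicalKrullDim X →
      topologicalKrullDim X ≤ ((3 : ℕ) : WithBot ℕ∞) →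
      ¬ Disjoint (closure ((Scheme.regularLocus X)ᶜ \ Scheme.hsMaxLocus X 3))
          (Scheme.hsMaxLocus X 3) →
        HSBody X 3 := by
  intro p hp k _ _ X f hsep hft hqc hred hreg h3 h3' hcor
  exact h p hp k X f hsep hft hqc hred hreg h3 h3' 3 h3' hcor

/-- **`SigmaMaxModificationsCorridor3 ↔ Corridor3@3` modulo the two printed theorems**: the item
stmt-ResolutionOfSingularities-19249 is, kernel-checked, its own level-`3` instance once CJS
Thm. 6.28 and CP 2019 Thm. 1.1 are granted — the all-levels quantifier carries no extra content on
the class `{dim ≤ 3}`. [cite: CossartJannsenSaito2020, Def. 6.15, Rem. 6.29]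
[cite: CossartPiltant2019, Thm. 1.1] -/
theorem sigmaMaxModificationsCorridor3_iff_base
    (hCJS : CossartJannsenSaito2020_sigmaMaxElimination.{0}) (hCP : CossartPiltant2019General.{0}) :
    SigmaMaxModificationsCorridor3 ↔
      ∀ p : ℕ, p.Prime → ∀ (k : Type) [Field k] [CharP k p] (X : Scheme.{0})
        (f : X ⟶ Spec (.of k)), IsSeparated f → LocallyOfFiniteType f → QuasiCompact f →
        IsReduced X → ¬ Scheme.IsRegular X → ((3 : ℕ) : WithBot ℕ∞) ≤ topologicalKrullDim X →
        topologicalKrullDim X ≤ ((3 : ℕ) : WithBot ℕ∞) →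
        ¬ Disjoint (closure ((Scheme.regularLocus X)ᶜ \ Scheme.hsMaxLocus X 3))
            (Scheme.hsMaxLocus X 3) →
          HSBody X 3 :=
  ⟨corridor3_base_of_corridor3, SigmaMaxModificationsCorridor3_of_base hCJS hCP⟩

/-- **All levels on the class `{dim ≤ 3}`, packaged**: modulo the two printed theorems and
`Corridor3@3`, every reduced separated finite-type non-regular `X/k` (`char k = p`) with
`dim X ≤ 3` admits a `Σ^max`-modification at EVERY level `N ≥ dim X` — i.e. the parent crux
`SigmaMaxModifications` restricted to `{dim ≤ 3}`, with no corridor hypothesis and no input from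
dimension `≥ 4`. [cite: CossartJannsenSaito2020, Def. 6.15, Rem. 6.29]
[cite: CossartPiltant2019, Thm. 1.1] -/
theorem sigmaMaxModifications_dim_le_three_of_base
    (hCJS : CossartJannsenSaito2020_sigmaMaxElimination.{0}) (hCP : CossartPiltant2019General.{0})
    (hcor : ∀ p : ℕ, p.Prime → ∀ (k : Type) [Field k] [CharP k p] (X : Scheme.{0})
      (f : X ⟶ Spec (.of k)), IsSeparated f → LocallyOfFiniteType f → QuasiCompact f →
      IsReduced X → ¬ Scheme.IsRegular X → ((3 : ℕ) : WithBot ℕ∞) ≤ topologicalKrullDim X →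
      topologicalKrullDim X ≤ ((3 : ℕ) : WithBot ℕ∞) →
      ¬ Disjoint (closure ((Scheme.regularLocus X)ᶜ \ Scheme.hsMaxLocus X 3))
          (Scheme.hsMaxLocus X 3) →
        HSBody X 3) :
    ∀ p : ℕ, p.Prime → ∀ (k : Type) [Field k] [CharP k p] (X : Scheme.{0})
      (f : X ⟶ Spec (.of k)), IsSeparated f → LocallyOfFiniteType f → QuasiCompact f →
      IsReduced X → ¬ Scheme.IsRegular X → topologicalKrullDim X ≤ ((3 : ℕ) : WithBot ℕ∞) →
      ∀ N : ℕ, topologicalKrullDim X ≤ (N : WithBot ℕ∞) → HSBody X N :=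
  fun p hp k _ _ X f hsep hft hqc hred hreg hd3 N hdim =>
    hsBody_of_dim_le_three_of_base hCJS hCP hcor p hp k N X f hsep hft hqc hred hreg hd3 hdim

end Summit.ResolutionOfSingularities.ResolutionOfSingularities.Theorems.SigmaMaxModificationsCorridor3

end
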